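import Summits.HodgeConjecture.HodgeConjecture.Theorems.H413SpectrumJunction
import Summits.HodgeConjecture.HodgeConjecture.Theorems.F0P2aStubS1SesqSchur
import Literature.NumberTheory.Automorphic.UnitaryCurveCotangentSpectralProjection
import Literature.NumberTheory.Automorphic.UnitaryGroupCongruenceLevels
import HarnessLib

/-!
# Crux `HLiu418`, K-lane E₂ — the rank-2 ORTHOGONALITY BOOTSTRAP (generic part): class maps and `ψ = r • ψ₁` from Schur + orthogonality-vanishing

Cell `hodgecm-mathlib`, FLOOR 0, programme P5 (`F0_AlbCm`); crux item `stmt-HodgeConjecture-24832` (`HCCMUnconditional.HLiu418`); seat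
F0P5-p02 (g2), `--supports stmt-HodgeConjecture-24832` (helper).  THEOREMS ONLY — no definition, no instance, no notation, no `sorry`.
Rank-2 SCALAR twin of ★ `Theorems/F0P2aCohIsotypicLineBootstrap` (the generic §3 of the rank-3 line `Cruxes/H413/Lines/F0_P2aCohIsotypicLine`, which
closed ★ `CotangentForms.cohIsotypicLine_hol`), over the chart-free cone carriers ★ `UnitaryCurveForms.rightRep₂` / `ContainsFun` of a rank-2 unitary datum
`U(J)`, `J ∈ M₂(E)`:
* `inner_rightRegular_rightRegular` (`R` unitary), `containsFun_sub_smul`;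
* `exists_clsMap₂` — the linear `σ`-equivariant CLASS MAP `w ↦ [toQuotFun (φ w)] ∈ P ⊂ L²` (★ `SpectrumJunction.toLp_toQuotFun_mul_right`);
* **`exists_eq_smul_of_orthVanish₂`** — S1 (★ `F0P2aStubS1SesqSchur.stubS1_holds`: group-generic Schur for invariant sesquilinear forms; compact open
  subgroup ★ `finCongruenceLevel ⊤`) + the orthogonality-vanishing property of a carrier `A` relative to `P` ⇒ for `σ` irreducible admissible, two
  `σ`-equivariant linear maps `ψ₁ ≠ 0`, `ψ` valued in `{f ∈ A ∣ P.ContainsFun f}` are proportional.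
Consumed by ★-candidate `Theorems/HLiu418E2OfCuts` (the heads for `A = holCotForms₂ … 𝔣` in the CM frame of the letter
`UnitaryCurveForms.cohIsotypicLine₂_hol`).  HONEST LABEL: HC_CM is proved only modulo the 7 printed citations until rung 0 closes; this file
discharges none of them.

## References
* [Liu2021] Y. Liu, Camb. J. Math. 9 (2021), App. D Lem. D.2 (2).  [BorelWallach2000] VI 4.11, VII 3.2.  [BorelJacquet1979] Corvallis PSPM 33.1, §4.6.
* [BernsteinZelevinsky1976] §2; [Bump1997] Prop. 4.2.4 (Schur for invariant forms).
-/

set_option autoImplicit false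
-- the mandated namespace has the single-problem summit's repeated segment (`HodgeConjecture.HodgeConjecture`)
set_option linter.dupNamespace false

noncomputable section

open MeasureTheory NumberField NumberField.InfinitePlace
open scoped InnerProductSpace ENNReal ComplexOrder Matrix

namespace Summit.HodgeConjecture.HodgeConjecture.Cruxes.HLiu418.E2Bootstrap

open Literature.NumberTheory.Automorphic Literature.NumberTheory.Automorphic.UnitaryGroup
open Literature.NumberTheory.Automorphic.UnitaryGroup.CotangentForms (toQuotFun)
open Literature.NumberTheory.Automorphic.UnitaryCurveForms
open Summit.HodgeConjecture.HodgeConjecture.Cruxes.H413.SpectrumJunction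
open Summit.HodgeConjecture.HodgeConjecture.Cruxes.H413 (F0P2aStubS1SesqSchur.stubS1_holds)

/-! ## §1 Scalar plumbing over a rank-2 unitary datum `(F, E, c, J)`: `ContainsFun` algebra, the class map, and THE BOOTSTRAP -/

section Generic

variable {F E : Type} [Field F] [NumberField F] [Field E] [NumberField E] [Algebra F E]
  {c : E ≃ₐ[F] E} {J : Matrix (Fin 2) (Fin 2) E}
  {μ : Measure (adelicGroupData F E c 2 J).automorphicQuotient} [(adelicGroupData F E c 2 J).IsAutomorphicMeasure μ]

/-- `⟪R(x) u, R(x) v⟫ = ⟪u, v⟫`: the regular representation preserves inner products (★ `norm_rightRegular_apply`; Mathlib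
`LinearIsometry.inner_map_map`). [cite: BorelJacquet1979, §4.6] -/
theorem inner_rightRegular_rightRegular (x : (adelicGroupData F E c 2 J).Adelic) (u v : (adelicGroupData F E c 2 J).L2 μ) :
    ⟪(adelicGroupData F E c 2 J).rightRegular μ x u, (adelicGroupData F E c 2 J).rightRegular μ x v⟫_ℂ = ⟪u, v⟫_ℂ :=
  let T : (adelicGroupData F E c 2 J).L2 μ →ₗᵢ[ℂ] (adelicGroupData F E c 2 J).L2 μ :=
    { toLinearMap := ((adelicGroupData F E c 2 J).rightRegular μ x :
          (adelicGroupData F E c 2 J).L2 μ →L[ℂ] (adelicGroupData F E c 2 J).L2 μ).toLinearMap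
      norm_map' := (adelicGroupData F E c 2 J).norm_rightRegular_apply μ x }
  T.inner_map_map u v

/-- `P.ContainsFun` is stable under `f ↦ f - r • h` (the classes of `P` form a submodule of `L²`). [cite: BorelJacquet1979, §4.6] -/
theorem containsFun_sub_smul (P : DiscreteAutomorphicRep (adelicGroupData F E c 2 J) μ)
    {f h : (adelicGroupData F E c 2 J).Adelic → ℂ} (hf : P.ContainsFun f) (hh : P.ContainsFun h) (r : ℂ) :
    P.ContainsFun (f - r • h) := by
  obtain ⟨h1, h1P⟩ := hf
  obtain ⟨h2, h2P⟩ := hh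
  have hfun : toQuotFun (adelicGroupData F E c 2 J) (f - r • h) =
      toQuotFun (adelicGroupData F E c 2 J) f - r • toQuotFun (adelicGroupData F E c 2 J) h := by
    funext y
    simp only [toQuotFun, Pi.sub_apply, Pi.smul_apply, smul_eq_mul]
  have hmem : MemLp (toQuotFun (adelicGroupData F E c 2 J) (f - r • h)) 2 μ := by
    rw [hfun]
    exact h1.sub (h2.const_smul r)
  refine ⟨hmem, ?_⟩
  have heq : hmem.toLp (toQuotFun (adelicGroupData F E c 2 J) (f - r • h)) =
      h1.toLp (toQuotFun (adelicGroupData F E c 2 J) f) - r • h2.toLp (toQuotFun (adelicGroupData F E c 2 J) h) := by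
    rw [← MemLp.toLp_const_smul, ← MemLp.toLp_sub]
    exact MemLp.toLp_congr _ _ (Filter.EventuallyEq.of_eq hfun)
  rw [heq]
  exact P.space.toSubmodule.sub_mem h1P (P.space.toSubmodule.smul_mem r h2P)

/-- **The class map.**  For a `σ`-equivariant linear `φ : W → (U(J)(𝔸) → ℂ)` with left-invariant values contained in `P`, `Λ : w ↦ [toQuotFun (φ w)]`
is LINEAR, valued in `P`, and intertwines `σ` with `R|_{U(J)(𝔸_f)}` (★ `toLp_toQuotFun_mul_right`); the `MemLp` proof inside `toLp` is irrelevant.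
[cite: BorelJacquet1979, §4.6] -/
theorem exists_clsMap₂ (P : DiscreteAutomorphicRep (adelicGroupData F E c 2 J) μ)
    {W : Type} [AddCommGroup W] [Module ℂ W] (σ : Representation ℂ (finAdelic F E c 2 J) W)
    (φ : W →ₗ[ℂ] ((adelicGroupData F E c 2 J).Adelic → ℂ))
    (hE : ∀ (k : finAdelic F E c 2 J) (w : W), φ (σ k w) = rightRep₂ F E c J k (φ w))
    (hleft : ∀ w, ∀ γ ∈ (adelicGroupData F E c 2 J).quotientSubgroup, ∀ x, φ w (γ * x) = φ w x)
    (hP : ∀ w, P.ContainsFun (φ w)) :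
    ∃ Λ : W →ₗ[ℂ] (adelicGroupData F E c 2 J).L2 μ,
      (∀ (w : W) (h : MemLp (toQuotFun (adelicGroupData F E c 2 J) (φ w)) 2 μ),
          Λ w = h.toLp (toQuotFun (adelicGroupData F E c 2 J) (φ w))) ∧
      (∀ w : W, Λ w ∈ P.space.toSubmodule) ∧
      (∀ (k : finAdelic F E c 2 J) (w : W),
          Λ (σ k w) = (adelicGroupData F E c 2 J).rightRegular μ (finAdelicToAdelic F E c 2 J k) (Λ w)) := by
  have hmem : ∀ w : W, MemLp (toQuotFun (adelicGroupData F E c 2 J) (φ w)) 2 μ := fun w => (hP w).choose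
  have hmemP : ∀ w : W, (hmem w).toLp (toQuotFun (adelicGroupData F E c 2 J) (φ w)) ∈ P.space.toSubmodule :=
    fun w => (hP w).choose_spec
  let Λ : W →ₗ[ℂ] (adelicGroupData F E c 2 J).L2 μ :=
    { toFun := fun w => (hmem w).toLp (toQuotFun (adelicGroupData F E c 2 J) (φ w))
      map_add' := fun w w' => by
        change (hmem (w + w')).toLp _ = (hmem w).toLp _ + (hmem w').toLp _
        rw [← MemLp.toLp_add]
        exact MemLp.toLp_congr _ _ (Filter.EventuallyEq.of_eq
          (funext fun y => by simp only [toQuotFun, map_add, Pi.add_apply]))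
      map_smul' := fun r w => by
        change (hmem (r • w)).toLp _ = r • (hmem w).toLp _
        rw [← MemLp.toLp_const_smul]
        exact MemLp.toLp_congr _ _ (Filter.EventuallyEq.of_eq
          (funext fun y => by simp only [toQuotFun, map_smul, Pi.smul_apply, smul_eq_mul])) }
  have hΛ : ∀ w : W, Λ w = (hmem w).toLp (toQuotFun (adelicGroupData F E c 2 J) (φ w)) := fun _ => rfl
  refine ⟨Λ, fun w h => hΛ w, fun w => by rw [hΛ]; exact hmemP w, fun k w => ?_⟩
  rw [hΛ, hΛ]
  have hfun : toQuotFun (adelicGroupData F E c 2 J) (φ (σ k w)) =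
      toQuotFun (adelicGroupData F E c 2 J) fun x => φ w (x * finAdelicToAdelic F E c 2 J k) := by
    funext y
    simp only [toQuotFun, hE, rightRep₂_apply]
  have hmemh : MemLp (toQuotFun (adelicGroupData F E c 2 J) fun x => φ w (x * finAdelicToAdelic F E c 2 J k)) 2 μ :=
    hfun ▸ hmem (σ k w)
  rw [show (hmem (σ k w)).toLp _ = hmemh.toLp _ from MemLp.toLp_congr _ _ (Filter.EventuallyEq.of_eq hfun)]
  exact toLp_toQuotFun_mul_right (hleft w) _ (hmem w) hmemh

/-- **THE BOOTSTRAP (rank 2, scalar).**  S1 (★ `F0P2aStubS1SesqSchur.stubS1_holds`) + the orthogonality-vanishing property of the carrier `A`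
relative to `P` (`hA`: a non-zero `U(J)(𝔸_f)`-stable `N ≤ A` contained in `P` and `f₃ ∈ A` contained in `P` with `⟪[f],[f₃]⟫ = 0` for all `f ∈ N`
force `f₃ = 0`) ⇒ for `σ` irreducible admissible, two `σ`-equivariant linear maps `ψ₁ ≠ 0`, `ψ` valued in `{f ∈ A ∣ P.ContainsFun f}` are
proportional: `ψ = r • ψ₁`.  (The sesquilinear forms `⟪Λ₁ ·, Λ₁ ·⟫`, `⟪Λ₁ ·, Λ ·⟫` of the class maps are `U(J)(𝔸_f)`-invariant since `R` is unitary;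
Schur gives `⟪Λ₁ w, Λ w'⟫ = c ⟪Λ₁ w, Λ₁ w'⟫`; apply `hA` to `N := range ψ₁`, `f₃ := (ψ - c • ψ₁) w'`.) [cite: Liu2021, App. D Lem. D.2 (2)]
[cite: BorelWallach2000, VII 3.2] [cite: Bump1997, Proposition 4.2.4] -/
theorem exists_eq_smul_of_orthVanish₂ (P : DiscreteAutomorphicRep (adelicGroupData F E c 2 J) μ)
    (A : Submodule ℂ ((adelicGroupData F E c 2 J).Adelic → ℂ))
    (hAleft : ∀ f ∈ A, ∀ γ ∈ (adelicGroupData F E c 2 J).quotientSubgroup, ∀ x, f (γ * x) = f x)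
    (hA : ∀ N : Submodule ℂ ((adelicGroupData F E c 2 J).Adelic → ℂ), N ≤ A →
      (∀ f ∈ N, P.ContainsFun f) → (∀ (k : finAdelic F E c 2 J), ∀ f ∈ N, rightRep₂ F E c J k f ∈ N) → N ≠ ⊥ →
      ∀ f₃ ∈ A, P.ContainsFun f₃ →
      (∀ f ∈ N, ∀ (hf : MemLp (toQuotFun (adelicGroupData F E c 2 J) f) 2 μ)
          (h₃ : MemLp (toQuotFun (adelicGroupData F E c 2 J) f₃) 2 μ),
        ⟪hf.toLp (toQuotFun (adelicGroupData F E c 2 J) f), h₃.toLp (toQuotFun (adelicGroupData F E c 2 J) f₃)⟫_ℂ = 0) →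
      f₃ = 0)
    {W : Type} [AddCommGroup W] [Module ℂ W] (σ : Representation ℂ (finAdelic F E c 2 J) W)
    (hirr : σ.IsIrreducible) (hadm : σ.IsAdmissible)
    (ψ₁ ψ : W →ₗ[ℂ] ((adelicGroupData F E c 2 J).Adelic → ℂ))
    (hE₁ : ∀ (k : finAdelic F E c 2 J) (w : W), ψ₁ (σ k w) = rightRep₂ F E c J k (ψ₁ w))
    (hV₁ : ∀ w, ψ₁ w ∈ A ∧ P.ContainsFun (ψ₁ w)) (hne : ψ₁ ≠ 0)
    (hE : ∀ (k : finAdelic F E c 2 J) (w : W), ψ (σ k w) = rightRep₂ F E c J k (ψ w))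
    (hV : ∀ w, ψ w ∈ A ∧ P.ContainsFun (ψ w)) :
    ∃ r : ℂ, ψ = r • ψ₁ := by
  obtain ⟨Λ₁, hΛ₁, -, hΛ₁e⟩ := exists_clsMap₂ P σ ψ₁ hE₁ (fun w => hAleft _ (hV₁ w).1) (fun w => (hV₁ w).2)
  obtain ⟨Λ, hΛ, -, hΛe⟩ := exists_clsMap₂ P σ ψ hE (fun w => hAleft _ (hV w).1) (fun w => (hV w).2)
  -- (1) the two sesquilinear forms are `U(J)(𝔸_f)`-invariant (`R` unitary)
  have hb₁ : ∀ (k : finAdelic F E c 2 J) (w w' : W), ⟪Λ₁ (σ k w), Λ₁ (σ k w')⟫_ℂ = ⟪Λ₁ w, Λ₁ w'⟫_ℂ := by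
    intro k w w'
    rw [hΛ₁e, hΛ₁e, inner_rightRegular_rightRegular]
  have hb₂ : ∀ (k : finAdelic F E c 2 J) (w w' : W), ⟪Λ₁ (σ k w), Λ (σ k w')⟫_ℂ = ⟪Λ₁ w, Λ w'⟫_ℂ := by
    intro k w w'
    rw [hΛ₁e, hΛe, inner_rightRegular_rightRegular]
  -- a compact open subgroup of `U(J)(𝔸_f)`: the integral congruence level
  have hK : ∃ K₀ : OpenSubgroup (finAdelic F E c 2 J), IsCompact (K₀ : Set (finAdelic F E c 2 J)) :=
    ⟨⟨finCongruenceLevel F E c 2 J ⊤, (isCompact_isOpen_finCongruenceLevel_top F E c 2 J).2⟩,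
      (isCompact_isOpen_finCongruenceLevel_top F E c 2 J).1⟩
  -- (2) Schur for invariant sesquilinear forms
  obtain ⟨c₀, hc₀⟩ := F0P2aStubS1SesqSchur.stubS1_holds (finAdelic F E c 2 J) W σ hirr hadm hK _ Λ₁ Λ hb₁ hb₂
  -- (3) the corrected map `ψ - c₀ • ψ₁`
  have hE₃ : ∀ (k : finAdelic F E c 2 J) (w : W), (ψ - c₀ • ψ₁) (σ k w) = rightRep₂ F E c J k ((ψ - c₀ • ψ₁) w) := by
    intro k w
    simp only [LinearMap.sub_apply, LinearMap.smul_apply, hE, hE₁, map_sub, map_smul]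
  have hV₃ : ∀ w, (ψ - c₀ • ψ₁) w ∈ A ∧ P.ContainsFun ((ψ - c₀ • ψ₁) w) := fun w =>
    ⟨A.sub_mem (hV w).1 (A.smul_mem c₀ (hV₁ w).1), by
      simpa only [LinearMap.sub_apply, LinearMap.smul_apply] using containsFun_sub_smul P (hV w).2 (hV₁ w).2 c₀⟩
  obtain ⟨Λ₃, hΛ₃, -, -⟩ := exists_clsMap₂ P σ (ψ - c₀ • ψ₁) hE₃ (fun w => hAleft _ (hV₃ w).1) (fun w => (hV₃ w).2)
  have hΛ₃eq : ∀ w' : W, Λ₃ w' = Λ w' - c₀ • Λ₁ w' := by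
    intro w'
    have h1 : MemLp (toQuotFun (adelicGroupData F E c 2 J) (ψ w')) 2 μ := (hV w').2.choose
    have h2 : MemLp (toQuotFun (adelicGroupData F E c 2 J) (ψ₁ w')) 2 μ := (hV₁ w').2.choose
    have hfun : toQuotFun (adelicGroupData F E c 2 J) ((ψ - c₀ • ψ₁) w') =
        toQuotFun (adelicGroupData F E c 2 J) (ψ w') - c₀ • toQuotFun (adelicGroupData F E c 2 J) (ψ₁ w') := by
      funext y
      simp only [toQuotFun, LinearMap.sub_apply, LinearMap.smul_apply, Pi.sub_apply, Pi.smul_apply, smul_eq_mul]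
    have h3 : MemLp (toQuotFun (adelicGroupData F E c 2 J) ((ψ - c₀ • ψ₁) w')) 2 μ := by
      rw [hfun]
      exact h1.sub (h2.const_smul c₀)
    rw [hΛ₃ w' h3, hΛ w' h1, hΛ₁ w' h2, ← MemLp.toLp_const_smul, ← MemLp.toLp_sub]
    exact MemLp.toLp_congr _ _ (Filter.EventuallyEq.of_eq hfun)
  have horth : ∀ w w' : W, ⟪Λ₁ w, Λ₃ w'⟫_ℂ = 0 := by
    intro w w'
    rw [hΛ₃eq, inner_sub_right, inner_smul_right, hc₀ w w', sub_self]
  -- (4)+(5) orthogonality-vanishing on `N := range ψ₁`, `f₃ := (ψ - c₀ • ψ₁) w'`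
  have hzero : ∀ w' : W, (ψ - c₀ • ψ₁) w' = 0 := by
    intro w'
    refine hA (LinearMap.range ψ₁) ?_ ?_ ?_ ?_ ((ψ - c₀ • ψ₁) w') (hV₃ w').1 (hV₃ w').2 ?_
    · rintro _ ⟨w, rfl⟩
      exact (hV₁ w).1
    · rintro _ ⟨w, rfl⟩
      exact (hV₁ w).2
    · rintro k _ ⟨w, rfl⟩
      exact LinearMap.mem_range.mpr ⟨σ k w, hE₁ k w⟩
    · intro h0
      exact hne (LinearMap.range_eq_bot.mp h0)
    · rintro _ ⟨w, rfl⟩ hf h₃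
      rw [← hΛ₁ w hf, ← hΛ₃ w' h₃]
      exact horth w w'
  have hψ : ψ - c₀ • ψ₁ = 0 := LinearMap.ext hzero
  exact ⟨c₀, sub_eq_zero.mp hψ⟩

end Generic

end Summit.HodgeConjecture.HodgeConjecture.Cruxes.HLiu418.E2Bootstrap

end
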